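import Literature.Geometry.Symplectic.TubeLogCutoff
import Mathlib.Analysis.Calculus.MeanValue
import HarnessLib

/-!
# Uniform first-order Taylor bounds along the axis of a periodic tube

Topic `Geometry/Symplectic`; namespace `Literature.Geometry.Symplectic`.  Theorems only; no named
fact, no `sorry`.  Let `F : ℝ⁴ → V` be `C²` on the open model tube `hondaTube r`, `2π`-periodic
in the axis coordinate, and vanishing on the axis.  On every closed sub-tube `|x| ≤ r₁ < r` we
get UNIFORM constants with

* `‖F q‖ ≤ C₁ |x|` and
* `‖F q - dF_{q₀e₀}(q - q₀e₀)‖ ≤ C₂ |x|²`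

(`exists_axis_taylor_bounds`; `|x| = ‖q - q₀e₀‖`), by the mean value inequality on convex slabs
and uniform bounds of `dF`, `d²F` on one compact period (periodicity).  These are the sizes of
the error terms `ω - x·S(θ)β = O(|x|²)` in the gluing along an even zero circle.

## References

* T. Perutz, *Zero-sets of near-symplectic forms*, J. Symplectic Geom. 4 (2006), §3 (proof of
  Lemma 3.1). [Perutz2006]
-/

noncomputable section

open scoped Manifold ContDiff Topology Real
open Set Function Filter Metric Real

namespace Literature.Geometry.Symplectic

variable {V : Type*} [NormedAddCommGroup V] [NormedSpace ℝ V]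

/-! ### Slabs around the axis -/

/-- The closed slab `|x| ≤ r₁` is convex. [folklore] -/
theorem convex_closedSlab (r₁ : ℝ) :
    Convex ℝ {q : EuclideanSpace ℝ (Fin 4) | ‖q - hondaAxisPoint (q 0)‖ ≤ r₁} := by
  obtain ⟨L, hL⟩ := exists_normalProjCLM
  have h : {q : EuclideanSpace ℝ (Fin 4) | ‖q - hondaAxisPoint (q 0)‖ ≤ r₁} =
      (L : EuclideanSpace ℝ (Fin 4) →ₗ[ℝ] EuclideanSpace ℝ (Fin 4)) ⁻¹' closedBall 0 r₁ := by
    ext q; simp [hL]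
  rw [h]
  exact (convex_closedBall _ _).linear_preimage _

/-- The closed slab `|x| ≤ r₁` lies in the open tube of any larger radius. [folklore] -/
theorem closedSlab_subset_hondaTube {r₁ r : ℝ} (h : r₁ < r) (hr₁ : 0 ≤ r₁) :
    {q : EuclideanSpace ℝ (Fin 4) | ‖q - hondaAxisPoint (q 0)‖ ≤ r₁} ⊆ hondaTube r := by
  intro q hq
  rw [mem_setOf_eq] at hq
  rw [mem_hondaTube, ← norm_sub_hondaAxisPoint_sq]
  have h0 : 0 ≤ ‖q - hondaAxisPoint (q 0)‖ := norm_nonneg _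
  nlinarith

/-- The axis foot of `q` has the same axis coordinate, hence is its own foot. [folklore] -/
theorem hondaAxisPoint_foot (q : EuclideanSpace ℝ (Fin 4)) :
    hondaAxisPoint ((hondaAxisPoint (q 0)) 0) = hondaAxisPoint (q 0) := by
  rw [hondaAxisPoint_apply_zero]

/-- **Periodicity of the derivative** of a periodic map. [folklore] -/
theorem fderiv_periodic {W : Type*} [NormedAddCommGroup W] [NormedSpace ℝ W] {F : W → V} {p : W}
    (hper : ∀ q, F (q + p) = F q) : ∀ q, fderiv ℝ F (q + p) = fderiv ℝ F q := fun q ↦ by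
  rw [← fderiv_comp_add_right p]
  have : (fun x ↦ F (x + p)) = F := funext hper
  rw [this]

/-! ### The bounds -/

/-- **Uniform first-order Taylor bounds along the axis** for a `C²`, `2π`-periodic map vanishing
on the axis: `‖F q‖ ≤ C₁ |x|` and `‖F q - dF_{q₀e₀}(q - q₀e₀)‖ ≤ C₂ |x|²` on `|x| ≤ r₁ < r`.
[cite: Perutz2006, §3 (proof of Lemma 3.1)] -/
theorem exists_axis_taylor_bounds {F : EuclideanSpace ℝ (Fin 4) → V} {r r₁ : ℝ}
    (hF : ContDiffOn ℝ 2 F (hondaTube r))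
    (hper : ∀ q, F (q + (2 * π) • EuclideanSpace.single (0 : Fin 4) (1 : ℝ)) = F q)
    (h0 : ∀ θ, F (hondaAxisPoint θ) = 0) (hr₁ : 0 < r₁) (hr₁r : r₁ < r) :
    ∃ C₁ C₂ : ℝ, 0 ≤ C₁ ∧ 0 ≤ C₂ ∧ ∀ q : EuclideanSpace ℝ (Fin 4),
      ‖q - hondaAxisPoint (q 0)‖ ≤ r₁ →
        ‖F q‖ ≤ C₁ * ‖q - hondaAxisPoint (q 0)‖ ∧
        ‖F q - fderiv ℝ F (hondaAxisPoint (q 0)) (q - hondaAxisPoint (q 0))‖ ≤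
          C₂ * ‖q - hondaAxisPoint (q 0)‖ ^ 2 := by
  set p : EuclideanSpace ℝ (Fin 4) := (2 * π) • EuclideanSpace.single (0 : Fin 4) (1 : ℝ) with hp
  set S : Set (EuclideanSpace ℝ (Fin 4)) := {q | ‖q - hondaAxisPoint (q 0)‖ ≤ r₁} with hS
  have hSconv : Convex ℝ S := convex_closedSlab r₁
  have hST : S ⊆ hondaTube r := closedSlab_subset_hondaTube hr₁r hr₁.le
  have hopen := isOpen_hondaTube r
  -- derivatives
  have hF's : ContDiffOn ℝ 1 (fderiv ℝ F) (hondaTube r) := hF.fderiv_of_isOpen hopen (by norm_num)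
  have hdiff : ∀ q ∈ hondaTube r, DifferentiableAt ℝ F q := fun q hq ↦
    (hF.contDiffAt (hopen.mem_nhds hq)).differentiableAt (by norm_num)
  have hdiff' : ∀ q ∈ hondaTube r, DifferentiableAt ℝ (fderiv ℝ F) q := fun q hq ↦
    (hF's.contDiffAt (hopen.mem_nhds hq)).differentiableAt (by norm_num)
  have hF'n : ContinuousOn (fun q ↦ ‖fderiv ℝ F q‖) (hondaTube r) :=
    (hF.continuousOn_fderiv_of_isOpen hopen (by norm_num)).norm
  have hF''n : ContinuousOn (fun q ↦ ‖fderiv ℝ (fderiv ℝ F) q‖) (hondaTube r) :=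
    (hF's.continuousOn_fderiv_of_isOpen hopen (by norm_num)).norm
  -- periodicity of the derivatives
  have hperF' : Function.Periodic (fderiv ℝ F) p := fderiv_periodic hper
  have hperF'' : Function.Periodic (fderiv ℝ (fderiv ℝ F)) p := fderiv_periodic hperF'
  -- one compact period of the closed slab
  set K : Set (EuclideanSpace ℝ (Fin 4)) := {q | q 0 ∈ Icc 0 (2 * π)} ∩ S with hK
  have hKc : IsCompact K := by
    refine Metric.isCompact_of_isClosed_isBounded ?_ ?_
    · refine (isClosed_Icc.preimage (EuclideanSpace.proj (0 : Fin 4)).continuous).inter ?_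
      obtain ⟨L, hL⟩ := exists_normalProjCLM
      have h : S = (fun q ↦ ‖L q‖) ⁻¹' Iic r₁ := by ext q; simp [hS, hL]
      rw [h]
      exact isClosed_Iic.preimage (continuous_norm.comp L.continuous)
    · refine (isBounded_iff_subset_closedBall 0).2 ⟨2 * π + r₁, fun q hq ↦ ?_⟩
      obtain ⟨hq0, hqS⟩ := hq
      rw [mem_closedBall_zero_iff]
      have h1 : ‖q‖ ≤ ‖hondaAxisPoint (q 0)‖ + ‖q - hondaAxisPoint (q 0)‖ := by
        calc ‖q‖ = ‖hondaAxisPoint (q 0) + (q - hondaAxisPoint (q 0))‖ := by rw [add_sub_cancel]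
          _ ≤ _ := norm_add_le _ _
      have h2 : ‖hondaAxisPoint (q 0)‖ ≤ 2 * π := by
        rw [hondaAxisPoint_eq_single, PiLp.norm_single, Real.norm_eq_abs, abs_le]
        simp only [mem_Icc] at hq0
        constructor <;> linarith [hq0.1, hq0.2, pi_pos]
      simp only [hS, mem_setOf_eq] at hqS
      linarith
  have hKT : K ⊆ hondaTube r := fun q hq ↦ hST hq.2
  obtain ⟨B₁, hB₁'⟩ := hKc.exists_bound_of_continuousOn (hF'n.mono hKT)
  obtain ⟨B₂, hB₂'⟩ := hKc.exists_bound_of_continuousOn (hF''n.mono hKT)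
  have hB₁ : ∀ x ∈ K, ‖fderiv ℝ F x‖ ≤ B₁ := fun x hx ↦ by
    have := hB₁' x hx
    rw [Real.norm_eq_abs] at this
    exact (le_abs_self _).trans this
  have hB₂ : ∀ x ∈ K, ‖fderiv ℝ (fderiv ℝ F) x‖ ≤ B₂ := fun x hx ↦ by
    have := hB₂' x hx
    rw [Real.norm_eq_abs] at this
    exact (le_abs_self _).trans this
  -- reduction of a slab point into the compact period
  have hred : ∀ q ∈ S, ‖fderiv ℝ F q‖ ≤ max B₁ 0 ∧ ‖fderiv ℝ (fderiv ℝ F) q‖ ≤ max B₂ 0 := by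
    intro q hq
    set k : ℤ := toIcoDiv two_pi_pos 0 (q 0) with hk
    set c : ℝ := -((k : ℝ) * (2 * π)) with hc
    set q' : EuclideanSpace ℝ (Fin 4) := q + c • EuclideanSpace.single (0 : Fin 4) (1 : ℝ) with hq'
    have hkp : ((k : ℝ) * (2 * π)) • EuclideanSpace.single (0 : Fin 4) (1 : ℝ) = k • p := by
      rw [← Int.cast_smul_eq_zsmul ℝ, hp, smul_smul]
    have hqq' : q = q' + k • p := by
      rw [hq', hc, ← hkp, add_assoc, ← add_smul, neg_add_cancel, zero_smul, add_zero]
    have hq'0 : q' 0 ∈ Icc 0 (2 * π) := by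
      have h := sub_toIcoDiv_zsmul_mem_Ico two_pi_pos 0 (q 0)
      rw [zero_add, ← hk, zsmul_eq_mul] at h
      have : q' 0 = q 0 - k * (2 * π) := by simp [hq', hc]; ring
      rw [this]; exact ⟨h.1, h.2.le⟩
    have hq'S : q' ∈ S := by
      simp only [hS, mem_setOf_eq, hq', sub_hondaAxisPoint_add_smul]; exact hq
    have hq'K : q' ∈ K := ⟨hq'0, hq'S⟩
    have e1 : fderiv ℝ F q = fderiv ℝ F q' := by rw [hqq']; exact (hperF'.zsmul k) q'
    have e2 : fderiv ℝ (fderiv ℝ F) q = fderiv ℝ (fderiv ℝ F) q' := by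
      rw [hqq']; exact (hperF''.zsmul k) q'
    exact ⟨by rw [e1]; exact (hB₁ q' hq'K).trans (le_max_left _ _),
      by rw [e2]; exact (hB₂ q' hq'K).trans (le_max_left _ _)⟩
  -- the bounds
  refine ⟨max B₁ 0, max B₂ 0, le_max_right _ _, le_max_right _ _, fun q hq ↦ ?_⟩
  have hqS : q ∈ S := hq
  set a := hondaAxisPoint (q 0) with ha
  have haS : a ∈ S := by
    simp only [hS, mem_setOf_eq, ha, hondaAxisPoint_foot, sub_self, norm_zero]; exact hr₁.le
  have hFa : F a = 0 := h0 _
  constructor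
  · have h := hSconv.norm_image_sub_le_of_norm_fderiv_le (fun x hx ↦ hdiff x (hST hx))
      (fun x hx ↦ (hred x hx).1) haS hqS
    rwa [hFa, sub_zero] at h
  · set R := ‖q - a‖ with hR
    set s := S ∩ closedBall a R with hs
    have hsconv : Convex ℝ s := hSconv.inter (convex_closedBall a R)
    have has : a ∈ s := ⟨haS, mem_closedBall_self (norm_nonneg _)⟩
    have hqs : q ∈ s := ⟨hqS, by rw [mem_closedBall, dist_eq_norm]⟩
    have hbound : ∀ x ∈ s, ‖fderiv ℝ F x - fderiv ℝ F a‖ ≤ max B₂ 0 * R := by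
      intro x hx
      have h1 := hSconv.norm_image_sub_le_of_norm_fderiv_le (f := fderiv ℝ F)
        (fun y hy ↦ hdiff' y (hST hy)) (fun y hy ↦ (hred y hy).2) haS hx.1
      have h2 : ‖x - a‖ ≤ R := by
        have := hx.2; rwa [mem_closedBall, dist_eq_norm] at this
      calc ‖fderiv ℝ F x - fderiv ℝ F a‖ ≤ max B₂ 0 * ‖x - a‖ := h1
        _ ≤ max B₂ 0 * R := mul_le_mul_of_nonneg_left h2 (le_max_right _ _)
    have h := hsconv.norm_image_sub_le_of_norm_fderiv_le' (fun x hx ↦ hdiff x (hST hx.1)) hbound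
      has hqs
    rw [hFa, sub_zero] at h
    calc ‖F q - fderiv ℝ F a (q - a)‖ ≤ max B₂ 0 * R * ‖q - a‖ := h
      _ = max B₂ 0 * ‖q - a‖ ^ 2 := by rw [hR]; ring

end Literature.Geometry.Symplectic

end
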